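import Literature.Topology.FourManifolds.LatticeFormsSplitting
import Literature.Topology.FourManifolds.LatticeFormsDefinite
import Literature.Topology.FourManifolds.LatticeFormsOrthoSumSignature
import Literature.Topology.FourManifolds.LatticeFormsRepresentsZeroProofs
import HarnessLib

/-!
# Unimodular lattices of signature zero have a basis `{λᵢ, μⱼ}` with `λᵢ·λⱼ = 0`, `λᵢ·μⱼ = δᵢⱼ`
(Kervaire–Milnor 1963, proof of Lemma 7.3, p. 529; Milnor 1961, Lemma 9)

Topic `Literature/Topology/FourManifolds`, companion of the lattice-form cluster `LatticeForms*.lean`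
(`LinearMap.BilinForm.IsUnimodular`, `signature`, …). This file PROVES the algebraic step of the
proof of Kervaire–Milnor's Lemma 7.3 (M. Kervaire, J. Milnor, *Groups of homotopy spheres I*,
Ann. of Math. 77 (1963), p. 529):

> "Since the quadratic form `λ → λ·λ` has determinant `±1` and signature zero, it is possible to
> choose a basis `{λ₁, …, λᵣ, μ₁, …, μᵣ}` for `HₖM` so that `λᵢ·λⱼ = 0`, `λᵢ·μⱼ = δᵢⱼ`. The proof
> is analogous to that of [17, Lemma 9], but somewhat simpler since we do not put any restriction
> on `μᵢ·μⱼ`."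

(`[17]` = J. Milnor, *A procedure for killing the homotopy groups of differentiable manifolds*,
Proc. Sympos. Pure Math. III (1961), Lemma 9.) This basis is the hypothesis of Kervaire–Milnor's
Lemma 7.1 (p. 526), the engine of the middle-dimensional surgery by which `H₂ₘM` is killed
(tree: hypothesis `hkill` of `HomotopySphere.mk_eq_mk_iff_sigmaGen_dvd_sub_of_killMiddleHomology`,
`HomotopySpheresSignatureKilling.lean`, under the named fact
`Literature.Topology.FourManifolds.HomotopySphere.mk_eq_mk_iff_sigmaGen_dvd_sub`, Thm. 7.5). No
parity hypothesis is made (for even forms the statement is the existence of a symplectic base,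
Serre, *A Course in Arithmetic*, Ch. V §2.2 Thm. 5 with §3.5; Kosinski, *Differential Manifolds*
(1993), X.3, proof of (3.4), p. 205).

* `LinearMap.BilinForm.isoPlane t` — the rank-two lattice `ℤx ⊕ ℤy` with `x·x = 0`, `x·y = 1`,
  `y·y = t` (Gram matrix `!![0, 1; 1, t]`), on `ℤ × ℤ`; symmetric, nonsingular, indefinite, of
  signature `0` (`signature_isoPlane`).
* `LinearMap.BilinForm.IsometryEquiv.splitIsoPlane` — **splitting off such a plane**: for a
  symmetric integral form `B` and `x, y` with `B x x = 0`, `B x y = 1`,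
  `B ≅ isoPlane (B y y) ⊕ B|{x,y}^⊥` (Serre, Ch. V §3.2 Lemma 1: a unimodular sublattice is an
  orthogonal direct summand; the tree's `IsometryEquiv.splitHyperbolic` is the case `B y y = 0`).
* `LinearMap.BilinForm.exists_basis_isotropic_dual` — **the Kervaire–Milnor basis**: a symmetric
  unimodular form `Q` of signature `0` on a finitely generated free `ℤ`-module `V` admits, for
  some `r` with `rank V = 2r`, a basis `b : Basis (Fin r ⊕ Fin r) ℤ V` with
  `Q (b (inl i)) (b (inl j)) = 0` and `Q (b (inl i)) (b (inr j)) = δᵢⱼ`. Proof by induction on the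
  rank: if `V ≠ 0` then `|σ| = 0 < rank`, so `Q` is indefinite (`isIndefinite_iff_abs_signature_lt_finrank`)
  and represents zero (Serre's Thm. 3, the tree theorem `exists_isotropic_of_isIndefinite_holds`);
  an indivisible isotropic `x` has a `y` with `x·y = 1` (`exists_isotropic_dual_pair`, Serre
  Lemma 3); split off the plane `ℤx ⊕ ℤy`, whose complement is unimodular of signature
  `σ(Q) - σ(plane) = 0` (`signature_prod`) and rank `rank V - 2`, and prepend `λ₁ = x`, `μ₁ = y`
  to a basis of the complement given by induction.

Everything is proved; no named fact is introduced. `ℤ`-lattices carry the canonical structure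
`AddCommGroup.toIntModule` internally (see `LatticeFormsOrthoSum.lean`); the exported theorem
allows an arbitrary `[Module ℤ V]` instance.

## References

* M. Kervaire, J. Milnor, *Groups of homotopy spheres I*, Ann. of Math. 77 (1963), 504–537,
  proof of Lemma 7.3 (p. 529), Lemma 7.1 (p. 526). doi:10.2307/1970128 [KervaireMilnorAnnals1963]
* J. Milnor, *A procedure for killing the homotopy groups of differentiable manifolds*, Proc.
  Sympos. Pure Math. III, AMS (1961), 39–55, Lemma 9. [MilnorKilling1961]
* J.-P. Serre, *A Course in Arithmetic* (GTM 7, 1973), Ch. V §2.2 (Thm. 3, Thm. 5), §3.2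
  (Lemmas 1, 3), §3.5. [Serre1973]
* A. Kosinski, *Differential Manifolds* (1993), Ch. X §3, proof of Thm. (3.4), p. 205.
  [Kosinski1993]
-/

open Module
open LinearMap (BilinForm)

universe u

namespace LinearMap.BilinForm

/-! ### The plane `ℤx ⊕ ℤy` with `x·x = 0`, `x·y = 1`, `y·y = t` -/

section IsoPlane

/-- **The isotropic–dual plane** `P_t`: the symmetric bilinear form on `ℤ × ℤ` with Gram matrix
`!![0, 1; 1, t]` in the basis `(1, 0), (0, 1)`, i.e.
`P_t (a, b) (c, d) = a d + b c + t b d` — the lattice spanned by an isotropic vector `x` and a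
vector `y` with `x·y = 1`, `y·y = t` (Kervaire–Milnor 1963, p. 529: `λ·λ = 0`, `λ·μ = 1`, no
restriction on `μ·μ`; for `t = 0` this is the hyperbolic plane `U`, Serre Ch. V §1.4.2).
[cite: KervaireMilnorAnnals1963, §7, proof of Lemma 7.3 (p. 529)] -/
def isoPlane (t : ℤ) : BilinForm ℤ (ℤ × ℤ) :=
  LinearMap.mk₂ ℤ (fun p q : ℤ × ℤ => p.1 * q.2 + p.2 * q.1 + t * (p.2 * q.2))
    (fun p p' q => by simp only [Prod.fst_add, Prod.snd_add]; ring)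
    (fun c p q => by simp only [Prod.smul_fst, Prod.smul_snd, smul_eq_mul]; ring)
    (fun p q q' => by simp only [Prod.fst_add, Prod.snd_add]; ring)
    (fun c p q => by simp only [Prod.smul_fst, Prod.smul_snd, smul_eq_mul]; ring)

/-- The values of `isoPlane t`. [folklore] -/
@[simp]
theorem isoPlane_apply (t : ℤ) (p q : ℤ × ℤ) :
    isoPlane t p q = p.1 * q.2 + p.2 * q.1 + t * (p.2 * q.2) := rfl

/-- `isoPlane t` is symmetric. [folklore] -/
theorem isSymm_isoPlane (t : ℤ) : (isoPlane t).IsSymm :=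
  ⟨fun p q => by simp only [isoPlane_apply]; ring⟩

/-- `isoPlane t` is nonsingular (its Gram matrix has determinant `-1`): pairing with `(1, 0)` and
`(0, 1)` recovers the coordinates. [folklore] -/
theorem separatingLeft_isoPlane (t : ℤ) : (isoPlane t).SeparatingLeft := by
  intro p hp
  have h1 := hp (1, 0)
  have h2 := hp (0, 1)
  simp only [isoPlane_apply, mul_zero, mul_one, zero_add, add_zero] at h1 h2
  refine Prod.ext ?_ ?_
  · change p.1 = 0
    linear_combination h2 - t * h1
  · change p.2 = 0
    exact h1

/-- `isoPlane t` is indefinite: `(1, 0)` is a non-zero isotropic vector. [folklore] -/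
theorem isIndefinite_isoPlane (t : ℤ) : (isoPlane t).IsIndefinite := by
  have h0 : isoPlane t (1, 0) (1, 0) = 0 := by simp
  have hne : ((1, 0) : ℤ × ℤ) ≠ 0 := fun h => one_ne_zero (congrArg Prod.fst h)
  rw [isIndefinite_iff, posDef_iff, negDef_iff]
  exact ⟨fun H => (H _ hne).ne' h0, fun H => (H _ hne).ne h0⟩

/-- `rank (ℤ × ℤ) = 2`. [folklore] -/
theorem finrank_int_prod_int : finrank ℤ (ℤ × ℤ) = 2 := by
  rw [Module.finrank_prod, Module.finrank_self]

/-- **`isoPlane t` has signature `0`**: it is nonsingular and indefinite of rank `2`, so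
`|σ| < 2` (`isIndefinite_iff_abs_signature_lt_finrank`) and `σ ≡ 2 (mod 2)`
(`signature_modEq_finrank_two`). [folklore] -/
theorem signature_isoPlane (t : ℤ) : (isoPlane t).signature = 0 := by
  have h1 := (isIndefinite_iff_abs_signature_lt_finrank (isSymm_isoPlane t)
    (separatingLeft_isoPlane t)).1 (isIndefinite_isoPlane t)
  have h2 := signature_modEq_finrank_two (isSymm_isoPlane t) (separatingLeft_isoPlane t)
  rw [finrank_int_prod_int] at h1 h2
  rw [abs_lt] at h1
  rw [Int.ModEq] at h2
  push_cast at h1 h2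
  omega

end IsoPlane

/-! ### Splitting off the plane `ℤx ⊕ ℤy` (Serre's Lemma 1 for this unimodular sublattice) -/

section Split

variable {M : Type*} [AddCommGroup M] {B : BilinForm ℤ M}

/-- **Splitting off an isotropic vector together with a dual vector.** For a symmetric integral
form `B` and `x, y` with `x·x = 0`, `x·y = 1` (and `y·y = t` arbitrary), the sublattice
`ℤx ⊕ ℤy` is unimodular (Gram `!![0, 1; 1, t]`), hence an orthogonal direct summand (Serre,
*A Course in Arithmetic*, Ch. V §3.2 Lemma 1): the map
`v ↦ ((B(y,v) − t B(x,v), B(x,v)), v − (B(y,v) − t B(x,v)) x − B(x,v) y)` is an isometry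
`B ≅ isoPlane (B y y) ⊕ B|{x,y}^⊥` (inverse `((a, b), w) ↦ a x + b y + w`); `B` need not be
unimodular. The case `B y y = 0` is the tree's `IsometryEquiv.splitHyperbolic`. This is the
decomposition `HₖM = (λ₁ℤ + μ₁ℤ) ⊕ …` implicit in Kervaire–Milnor 1963, p. 529 and in the proof of
Lemma 7.1 (p. 527). [cite: Serre1973, Ch. V §3.2 Lemma 1] [cite: KervaireMilnorAnnals1963, §7, proof of Lemma 7.3 (p. 529)] -/
noncomputable def IsometryEquiv.splitIsoPlane (hB : B.IsSymm) (x y : M) (hx : B x x = 0)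
    (hxy : B x y = 1) :
    B.IsometryEquiv
      ((isoPlane (B y y)).prod (B.restrict (B.orthogonal (Submodule.span ℤ {x, y})))) :=
  have hyx : B y x = 1 := by rw [hB.eq y x, hxy]
  { toFun := fun v => ((B y v - B y y * B x v, B x v),
      ⟨v - (B y v - B y y * B x v) • x - B x v • y, by
        rw [mem_orthogonal_span_pair_iff]
        simp only [map_sub, LinearMap.BilinForm.smul_right, hx, hxy, hyx]
        constructor <;> ring⟩)
    invFun := fun p => p.1.1 • x + p.1.2 • y + (p.2 : M)
    map_add' := fun v w => by
      ext
      · simp only [map_add, Prod.mk_add_mk]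
        ring
      · simp only [map_add, Prod.mk_add_mk]
      · simp only [map_add, Prod.mk_add_mk, Submodule.coe_add]
        rw [show B y v + B y w - B y y * (B x v + B x w) =
            (B y v - B y y * B x v) + (B y w - B y y * B x w) by ring, add_smul, add_smul]
        abel
    map_smul' := fun c v => by
      ext
      · simp only [LinearMap.BilinForm.smul_right, RingHom.id_apply, Prod.smul_mk, smul_eq_mul]
        ring
      · simp only [LinearMap.BilinForm.smul_right, RingHom.id_apply, Prod.smul_mk, smul_eq_mul]
      · simp only [LinearMap.BilinForm.smul_right, RingHom.id_apply, Prod.smul_mk,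
          Submodule.coe_smul_of_tower, smul_sub, smul_smul, smul_eq_mul]
        ring_nf
    left_inv := fun v => by
      simp only
      abel
    right_inv := fun p => by
      obtain ⟨⟨a, b⟩, w, hw⟩ := p
      obtain ⟨hxw, hyw⟩ := (mem_orthogonal_span_pair_iff B).mp hw
      have h0 : B y (a • x + b • y + w) = a + B y y * b := by
        simp only [map_add, LinearMap.BilinForm.smul_right, hyx, hyw]
        ring
      have h1 : B x (a • x + b • y + w) = b := by
        simp only [map_add, LinearMap.BilinForm.smul_right, hx, hxy, hxw]
        ring
      ext
      · change B y (a • x + b • y + w) - B y y * B x (a • x + b • y + w) = a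
        rw [h0, h1]
        ring
      · exact h1
      · simp only [h0, h1, add_sub_cancel_right]
        abel
    map_app' := fun v w => by
      simp only [prod_apply, isoPlane_apply, restrict_apply, LinearMap.domRestrict_apply, map_sub,
        LinearMap.sub_apply, LinearMap.BilinForm.smul_left, LinearMap.BilinForm.smul_right, hx,
        hxy, hyx, hB.eq v x, hB.eq v y]
      ring }

/-- The components of `splitIsoPlane`. [folklore] -/
theorem IsometryEquiv.splitIsoPlane_apply (hB : B.IsSymm) (x y : M) (hx : B x x = 0)
    (hxy : B x y = 1) (v : M) :
    (IsometryEquiv.splitIsoPlane hB x y hx hxy v).1 = (B y v - B y y * B x v, B x v) ∧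
      ((IsometryEquiv.splitIsoPlane hB x y hx hxy v).2 : M) =
        v - (B y v - B y y * B x v) • x - B x v • y :=
  ⟨rfl, rfl⟩

/-- The inverse of `splitIsoPlane`: `((a, b), w) ↦ a x + b y + w`. [folklore] -/
theorem IsometryEquiv.splitIsoPlane_symm_apply (hB : B.IsSymm) (x y : M) (hx : B x x = 0)
    (hxy : B x y = 1) (p : (ℤ × ℤ) × ↥(B.orthogonal (Submodule.span ℤ {x, y}))) :
    (IsometryEquiv.splitIsoPlane hB x y hx hxy).symm p = p.1.1 • x + p.1.2 • y + (p.2 : M) :=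
  rfl

/-- In a unimodular lattice the orthogonal complement `{x,y}^⊥` of such a pair is unimodular
(Serre, *A Course in Arithmetic*, Ch. V §3.2 Lemma 1). [cite: Serre1973, Ch. V §3.2 Lemma 1] -/
theorem isUnimodular_restrict_orthogonal_isoPair (hu : B.IsUnimodular) (hB : B.IsSymm) (x y : M)
    (hx : B x x = 0) (hxy : B x y = 1) :
    (B.restrict (B.orthogonal (Submodule.span ℤ {x, y}))).IsUnimodular := by
  have h := isUnimodular_of_equivalent ⟨IsometryEquiv.splitIsoPlane hB x y hx hxy⟩ hu
  exact (isUnimodular_prod_iff.mp h).2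

/-- Rank bookkeeping: `rank M = rank {x,y}^⊥ + 2`. [folklore] -/
theorem finrank_eq_finrank_orthogonal_isoPair_add_two [Module.Finite ℤ M] (hB : B.IsSymm)
    (x y : M) (hx : B x x = 0) (hxy : B x y = 1) :
    finrank ℤ M = finrank ℤ ↥(B.orthogonal (Submodule.span ℤ {x, y})) + 2 := by
  rw [(IsometryEquiv.splitIsoPlane hB x y hx hxy).toLinearEquiv.finrank_eq, finrank_prod_eq,
    finrank_int_prod_int, add_comm]

/-- Signature bookkeeping: `σ(B) = σ(B|{x,y}^⊥)` (`σ` is additive over orthogonal sums,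
`signature_prod`, and `σ(ℤx ⊕ ℤy) = 0`, `signature_isoPlane`). [cite: Serre1973, Ch. V §1.3.7] -/
theorem signature_eq_signature_restrict_orthogonal_isoPair [Module.Finite ℤ M] (hB : B.IsSymm)
    (x y : M) (hx : B x x = 0) (hxy : B x y = 1) :
    B.signature = (B.restrict (B.orthogonal (Submodule.span ℤ {x, y}))).signature := by
  rw [signature_eq_of_equivalent ⟨IsometryEquiv.splitIsoPlane hB x y hx hxy⟩,
    signature_prod _ _ (isSymm_isoPlane _) (hB.restrict _), signature_isoPlane, zero_add]

end Split

/-! ### The Kervaire–Milnor basis -/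

section KMBasis

/-- The standard basis `(1, 0), (0, 1)` of `ℤ × ℤ`, indexed by `Unit ⊕ Unit`. [folklore] -/
noncomputable def isoPlaneBasis : Basis (Unit ⊕ Unit) ℤ (ℤ × ℤ) :=
  (Basis.singleton Unit ℤ).prod (Basis.singleton Unit ℤ)

/-- The first vector of `isoPlaneBasis` is `(1, 0)`. [folklore] -/
@[simp]
theorem isoPlaneBasis_inl (a : Unit) : isoPlaneBasis (Sum.inl a) = (1, 0) := by
  simp [isoPlaneBasis, Basis.prod_apply]

/-- The second vector of `isoPlaneBasis` is `(0, 1)`. [folklore] -/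
@[simp]
theorem isoPlaneBasis_inr (a : Unit) : isoPlaneBasis (Sum.inr a) = (0, 1) := by
  simp [isoPlaneBasis, Basis.prod_apply]

/-- **The Kervaire–Milnor basis, inductive form** (canonical `ℤ`-module structures, index type in
`Type`): every symmetric unimodular lattice of signature `0` and rank `≤ n` has a basis indexed by
`ι ⊕ ι` whose first half is totally isotropic and dually paired with the second half. Induction on
`n` as in the file header. [cite: KervaireMilnorAnnals1963, §7, proof of Lemma 7.3 (p. 529)] -/
theorem exists_basis_isotropic_dual_aux (n : ℕ) :
    ∀ (M : Type u) [AddCommGroup M] [Module.Finite ℤ M] [Module.Free ℤ M] (B : BilinForm ℤ M),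
      finrank ℤ M ≤ n → B.IsSymm → B.IsUnimodular → B.signature = 0 →
      ∃ (ι : Type) (_ : Fintype ι) (b : Basis (ι ⊕ ι) ℤ M),
        (∀ i j, B (b (Sum.inl i)) (b (Sum.inl j)) = 0) ∧
          (∀ i, B (b (Sum.inl i)) (b (Sum.inr i)) = 1) ∧
            ∀ i j, i ≠ j → B (b (Sum.inl i)) (b (Sum.inr j)) = 0 := by
  induction n with
  | zero =>
    intro M _ _ _ B hn _ _ _
    haveI : Subsingleton M := Module.finrank_zero_iff.1 (Nat.le_zero.1 hn)
    exact ⟨PEmpty, inferInstance, Basis.empty _, fun i => i.elim, fun i => i.elim, fun i => i.elim⟩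
  | succ n ih =>
    intro M _ _ _ B hn hB hu hsig
    rcases subsingleton_or_nontrivial M with hM | hM
    · exact ⟨PEmpty, inferInstance, Basis.empty _, fun i => i.elim, fun i => i.elim,
        fun i => i.elim⟩
    haveI : B.IsPerfPair := hu
    -- `|σ| = 0 < rank`: `B` is indefinite, hence represents zero (Serre's Thm. 3)
    have hind : B.IsIndefinite := by
      rw [isIndefinite_iff_abs_signature_lt_finrank hB hu.separatingLeft, hsig, abs_zero]
      exact_mod_cast Module.finrank_pos
    obtain ⟨x₀, hx₀0, hx₀⟩ := exists_isotropic_of_isIndefinite_holds B hB hu hind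
    -- an indivisible isotropic `x` and `y` with `x·y = 1` (Serre's Lemma 3)
    obtain ⟨x, y, hx, hxy⟩ := exists_isotropic_dual_pair hx₀0 hx₀
    -- split off the plane `ℤx ⊕ ℤy`
    set W : Submodule ℤ M := B.orthogonal (Submodule.span ℤ {x, y}) with hWdef
    have hW2 : finrank ℤ M = finrank ℤ W + 2 :=
      finrank_eq_finrank_orthogonal_isoPair_add_two hB x y hx hxy
    have hWu : (B.restrict W).IsUnimodular := isUnimodular_restrict_orthogonal_isoPair hu hB x y hx hxy
    have hWσ : (B.restrict W).signature = 0 := by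
      rw [← signature_eq_signature_restrict_orthogonal_isoPair hB x y hx hxy, hsig]
    obtain ⟨ι, _, b₀, h0, h1, h2⟩ := ih W (B.restrict W) (by omega) (hB.restrict W) hWu hWσ
    -- prepend `λ = x`, `μ = y`
    let Φ := IsometryEquiv.splitIsoPlane hB x y hx hxy
    let b : Basis ((Unit ⊕ ι) ⊕ (Unit ⊕ ι)) ℤ M :=
      (((isoPlaneBasis.prod b₀).reindex (Equiv.sumSumSumComm Unit Unit ι ι)).map
        Φ.toLinearEquiv.symm)
    have key : ∀ a a', B (b a) (b a') =
        ((isoPlane (B y y)).prod (B.restrict W)) ((isoPlaneBasis.prod b₀)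
          ((Equiv.sumSumSumComm Unit Unit ι ι).symm a))
          ((isoPlaneBasis.prod b₀) ((Equiv.sumSumSumComm Unit Unit ι ι).symm a')) := by
      intro a a'
      simp only [b, Basis.map_apply, Basis.reindex_apply]
      exact Φ.symm.map_app _ _
    refine ⟨Unit ⊕ ι, inferInstance, b, ?_, ?_, ?_⟩
    · rintro (a | i) (a' | j)
      · rw [key]; simp [Basis.prod_apply, prod_apply]
      · rw [key]; simp [Basis.prod_apply, prod_apply]
      · rw [key]; simp [Basis.prod_apply, prod_apply]
      · rw [key]; simpa [Basis.prod_apply, prod_apply] using h0 i j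
    · rintro (a | i)
      · rw [key]; simp [Basis.prod_apply, prod_apply]
      · rw [key]; simpa [Basis.prod_apply, prod_apply] using h1 i
    · rintro (a | i) (a' | j) hij
      · exact absurd (congrArg Sum.inl (Subsingleton.elim a a')) hij
      · rw [key]; simp [Basis.prod_apply, prod_apply]
      · rw [key]; simp [Basis.prod_apply, prod_apply]
      · rw [key]
        simpa [Basis.prod_apply, prod_apply] using h2 i j fun h => hij (congrArg Sum.inr h)

/-- **Kervaire–Milnor's basis `{λ₁, …, λᵣ, μ₁, …, μᵣ}`** (*Groups of homotopy spheres I* (1963),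
proof of Lemma 7.3, p. 529: "Since the quadratic form has determinant `±1` and signature zero, it
is possible to choose a basis `{λ₁, …, λᵣ, μ₁, …, μᵣ}` for `HₖM` so that `λᵢ·λⱼ = 0`,
`λᵢ·μⱼ = δᵢⱼ`"; Milnor 1961, Lemma 9; for even forms Serre, Ch. V §2.2 Thm. 5 / Kosinski X.3,
p. 205, "symplectic base"). For a symmetric unimodular bilinear form `Q` of signature `0` on a
finitely generated free `ℤ`-module `V`: there are `r` with `rank V = 2r` and a basis
`b : Basis (Fin r ⊕ Fin r) ℤ V` — `λᵢ = b (inl i)`, `μⱼ = b (inr j)` — with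
`Q λᵢ λⱼ = 0` and `Q λᵢ μⱼ = δᵢⱼ` for all `i, j` (nothing is asserted about `Q μᵢ μⱼ`). This is
the hypothesis on `HₖM` of Kervaire–Milnor's Lemma 7.1 (p. 526).
[cite: KervaireMilnorAnnals1963, §7, proof of Lemma 7.3 (p. 529), with Lemma 7.1 (p. 526)] [cite: Serre1973, Ch. V §2.2 Thm. 3 and §3.2 Lemmas 1, 3] -/
theorem exists_basis_isotropic_dual {V : Type u} [AddCommGroup V] [inst : Module ℤ V]
    [Module.Finite ℤ V] [Module.Free ℤ V] {Q : BilinForm ℤ V} (hs : Q.IsSymm)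
    (hu : Q.IsUnimodular) (hσ : Q.signature = 0) :
    ∃ (r : ℕ) (b : Basis (Fin r ⊕ Fin r) ℤ V), finrank ℤ V = 2 * r ∧
      (∀ i j, Q (b (Sum.inl i)) (b (Sum.inl j)) = 0) ∧
        ∀ i j, Q (b (Sum.inl i)) (b (Sum.inr j)) = if i = j then 1 else 0 := by
  obtain rfl : inst = AddCommGroup.toIntModule V := Subsingleton.elim _ _
  obtain ⟨ι, _, b, h0, h1, h2⟩ :=
    exists_basis_isotropic_dual_aux (finrank ℤ V) V Q le_rfl hs hu hσ
  classical
  let e : ι ≃ Fin (Fintype.card ι) := Fintype.equivFin ι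
  refine ⟨Fintype.card ι, b.reindex (e.sumCongr e), ?_, fun i j => ?_, fun i j => ?_⟩
  · rw [Module.finrank_eq_card_basis b, Fintype.card_sum, two_mul]
  · simp only [Basis.reindex_apply, Equiv.sumCongr_symm, Equiv.sumCongr_apply, Sum.map_inl]
    exact h0 _ _
  · simp only [Basis.reindex_apply, Equiv.sumCongr_symm, Equiv.sumCongr_apply, Sum.map_inl,
      Sum.map_inr]
    by_cases hij : i = j
    · subst hij
      rw [if_pos rfl]
      exact h1 _
    · rw [if_neg hij]
      exact h2 _ _ fun h => hij (e.symm.injective h)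

/-- The dual relations read from the other side: `Q μⱼ λᵢ = δᵢⱼ` as well, for symmetric `Q`.
[folklore] -/
theorem apply_inr_inl_of_basis_isotropic_dual {V : Type u} [AddCommGroup V] [Module ℤ V]
    {Q : BilinForm ℤ V} (hs : Q.IsSymm) {r : ℕ} {b : Basis (Fin r ⊕ Fin r) ℤ V}
    (h1 : ∀ i j, Q (b (Sum.inl i)) (b (Sum.inr j)) = if i = j then 1 else 0) (i j : Fin r) :
    Q (b (Sum.inr j)) (b (Sum.inl i)) = if i = j then 1 else 0 := by
  rw [hs.eq, h1]

/-- **Coordinates in a Kervaire–Milnor basis**: pairing with `λᵢ` reads off the `μᵢ`-coordinate,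
`Q λᵢ v = (b.repr v) (inr i)`, since `Q λᵢ λⱼ = 0` and `Q λᵢ μⱼ = δᵢⱼ` (so the `λ`'s span a
totally isotropic direct summand of half rank, a Lagrangian). [folklore] -/
theorem apply_inl_eq_repr_inr {V : Type u} [AddCommGroup V] [Module ℤ V]
    {Q : BilinForm ℤ V} {r : ℕ} {b : Basis (Fin r ⊕ Fin r) ℤ V}
    (h0 : ∀ i j, Q (b (Sum.inl i)) (b (Sum.inl j)) = 0)
    (h1 : ∀ i j, Q (b (Sum.inl i)) (b (Sum.inr j)) = if i = j then 1 else 0) (i : Fin r) (v : V) :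
    Q (b (Sum.inl i)) v = b.repr v (Sum.inr i) := by
  classical
  conv_lhs => rw [← b.linearCombination_repr v, Finsupp.linearCombination_apply, Finsupp.sum,
    map_sum]
  simp only [LinearMap.BilinForm.smul_right]
  rw [Finset.sum_eq_single (Sum.inr i)]
  · rw [h1, if_pos rfl, mul_one]
  · rintro (j | j) _ hj
    · rw [h0, mul_zero]
    · rw [h1, if_neg (fun h => hj (by rw [h])), mul_zero]
  · intro hi
    rw [Finsupp.notMem_support_iff.mp hi, zero_mul]

end KMBasis

end LinearMap.BilinForm
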